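import Mathlib
import Literature.Analysis.FluidPDE.Tao2016AveragedNS.ShiftSetCascadeFlows
import Literature.Analysis.FluidPDE.Tao2016AveragedNS.ShiftSetCascadeFlux
import Summits.NavierStokesRegularity.NavierStokesRegularity.Theorems.TaoLadderRungTwoFlatCertificateGlueCheckerChainBoxOn
import HarnessLib

/-!
# Certificate glue on a shift set `𝕊`, XXIX: THE BRANCH CHECKER — ONE Boolean test per step record (all of C2–C9, C13, the box tables, signs,
  the hand-over), the definitional mesh `tOf rec`, the transit test on the box, and the start-node inclusion of a branch box; output = exactly the
  per-branch hypotheses `ht0 / hmono / hstep / hhull / hbox` of glue XXII `htrap_of_branchMeshes` / `hland_of_branchMeshes`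
  (helper for items stmt-NavierStokesRegularity-22987 `FlatGapCertificatesV2` (crux K_A♭ of route TaoLadderRungTwoFlat) and stmt-24295 K_A₂(64);
  cell harvest/h2-tao-ladder, p1 g15; CHECKER-SPEC-v3 §3 (iv)–(v))

`checkGlobal` = the once-per-certificate tests (square-root enclosures, `0 ≤ b`, the (B)-table C1); `checkStepBox rec box j` = every test of
step `j` (glue XXVIII-b `stepCert_of_rec_box`) as ONE Boolean; `stepCert_of_checkStepBox`: both pass ⇒ `StepCert` of step `j` on the mesh
`tOf rec j = h 0 + ⋯ + h (j−1)` with nodes `nodeOf rec` and hulls `hullOfB`; `checkTransit` / `hullBound_of_checkTransit`: the weighted box of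
step `j` inside the open `M`-box ⇒ every hull state satisfies `|y i k| < M k` on the window; `checkIdFrame` / `node0_of_box`: a record starting
with the identity frame contains the weighted branch box `|pxcoord y − x 0| ≤ r 0`.

HONEST FRAMING: Tao-type MODEL lattices (Tao 2016 §4/§6 vocabulary, shift-set parametrised); soundness of a checker — NO certificate
instance exists in the tree, nothing is certified here, no stub is closed, nothing here is a statement about the Navier–Stokes equations.
-/

-- the sub-problem namespace repeats the summit name by design (D-0017)
set_option linter.dupNamespace false

namespace Summit.NavierStokesRegularity.NavierStokesRegularity.Theorems

open Set Finset Literature.Analysis.FluidPDE Literature.Analysis.FluidPDE.TaoCascade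
open Summit.NavierStokesRegularity.NavierStokesRegularity.Theorems.TaylorModelCert
open Summit.NavierStokesRegularity.NavierStokesRegularity.Theorems.TaylorModelReadout

namespace CertificateGlueOn

variable {m : ℕ} {Kb Ka : ℤ}

/-! ### The definitional mesh -/

/-- The mesh DEFINED by the step lengths: `tOf rec j = h 0 + ⋯ + h (j−1)`. [folklore] -/
def tOf (rec : ℕ → StepRec) (j : ℕ) : ℝ := ∑ l ∈ Finset.range j, ((rec l).h : ℝ)

/-- `tOf rec 0 = 0`. [folklore] -/
theorem tOf_zero (rec : ℕ → StepRec) : tOf rec 0 = 0 := by simp [tOf]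

/-- `tOf rec (j+1) − tOf rec j = h j`. [folklore] -/
theorem tOf_succ_sub (rec : ℕ → StepRec) (j : ℕ) : tOf rec (j + 1) - tOf rec j = ((rec j).h : ℝ) := by
  simp [tOf, Finset.sum_range_succ]

/-- A positive step length makes the mesh increase. [folklore] -/
theorem tOf_lt_succ {rec : ℕ → StepRec} {j : ℕ} (h : 0 < (rec j).h) : tOf rec j < tOf rec (j + 1) := by
  have := tOf_succ_sub rec j
  have h' : (0 : ℝ) < ((rec j).h : ℝ) := by exact_mod_cast h
  linarith

/-- The rational value of the mesh: `∑_{l<j} h l`. [folklore] -/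
def sumH (rec : ℕ → StepRec) (j : ℕ) : ℚ := ∑ l ∈ Finset.range j, (rec l).h

/-- `tOf` is the cast of `sumH`. [folklore] -/
theorem tOf_eq_cast (rec : ℕ → StepRec) (j : ℕ) : tOf rec j = ((sumH rec j : ℚ) : ℝ) := by
  simp [tOf, sumH]

/-- `c ≤ tOf rec N` from the rational test `c ≤ sumH rec N`. [folklore] -/
theorem le_tOf_of_le_sumH {rec : ℕ → StepRec} {N : ℕ} {c : ℚ} (h : c ≤ sumH rec N) : (c : ℝ) ≤ tOf rec N := by
  rw [tOf_eq_cast]; exact_mod_cast h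

/-! ### The hand-over and the identity frame as Boolean tests -/

/-- The hand-over test (decidable equality of the dyadic data). [folklore] -/
def checkHandsOver (s s' : StepRec) : Bool :=
  decide (s'.x = s.x') && decide (s'.C = s.Cn) && decide (s'.r = s.r') && decide (s'.E₀ = s.E₁ + s.A)

/-- `handsOver` from the test. [folklore] -/
theorem handsOver_of_check {s s' : StepRec} (h : checkHandsOver s s' = true) : handsOver s s' := by
  simp only [checkHandsOver, Bool.and_eq_true, decide_eq_true_eq] at h
  exact ⟨h.1.1.1, h.1.1.2, h.1.2, h.2⟩

/-- The identity-frame test: `C r c = [r = c]` as dyads. [folklore] -/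
def checkIdFrame (n : ℕ) (C : Array (Array Dyad)) : Bool :=
  (List.range n).all fun r => (List.range n).all fun c => decide (dyadToRat (dmgetD C r c) = if r = c then 1 else 0)

/-- `dmat C = 1` from the identity-frame test. [folklore] -/
theorem dmat_eq_one_of_check {n : ℕ} {C : Array (Array Dyad)} (h : checkIdFrame n C = true) : dmat (n := n) C = 1 := by
  simp only [checkIdFrame, List.all_eq_true, List.mem_range, decide_eq_true_eq] at h
  ext r c
  have hrc := h r r.2 c c.2
  have hcast : ((dyadToRat (dmgetD C r c) : ℚ) : ℝ) = ((if (r : ℕ) = c then 1 else 0 : ℚ) : ℝ) := by rw [hrc]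
  rw [cast_dyadToRat] at hcast
  unfold dmat
  rw [hcast, Matrix.one_apply]
  by_cases h1 : r = c
  · subst h1; simp
  · have h2 : (r : ℕ) ≠ c := fun e => h1 (Fin.ext e)
    simp [h1, h2]

/-- **Start-node inclusion of a branch box**: a record starting with the identity frame and `0 ≤ E₀` contains every state whose weighted
coordinates lie within `r 0` of `x 0` (glue XXV-c `pinPara_one_of_box`). [folklore] -/
theorem node0_of_box {ωq : Fin m → ℤ → ℚ} {rec : ℕ → StepRec} (hC : checkIdFrame (m * winLen Kb Ka) (rec 0).C = true)
    (hE : 0 ≤ (rec 0).E₀) {y : Fin m → ℤ → ℝ}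
    (hy : ∀ c, |pxcoord Kb Ka (fun i k => (ωq i k : ℝ)) y c - dvec (n := m * winLen Kb Ka) (rec 0).x c| ≤
      dvec (n := m * winLen Kb Ka) (rec 0).r c) :
    nodeOf Kb Ka ωq rec 0 y := by
  unfold nodeOf
  rw [dmat_eq_one_of_check hC]
  have hE' : (0 : ℝ) ≤ ((rec 0).E₀ : ℝ) := by exact_mod_cast hE
  refine ⟨pxcoord Kb Ka (fun i k => (ωq i k : ℝ)) y - dvec (n := m * winLen Kb Ka) (rec 0).x, 0,
    fun c => by simpa using hy c, fun c => by simpa using hE', ?_⟩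
  simp

/-! ### The transit test on the box -/

/-- **The transit test** of step `j`: the weighted box `[lo, hi]·ω` lies in the OPEN `M`-box, per window coordinate. [folklore] -/
def checkTransit (m : ℕ) (Kb Ka : ℤ) (ωq : Fin m → ℤ → ℚ) (Mq : ℤ → ℚ) (loD hiD : Array Dyad) : Bool :=
  (List.finRange m).all fun i => (List.range (winLen Kb Ka)).all fun cc =>
    decide (ωq i ((cc : ℤ) - Kb) * dyadToRat (dgetD hiD (cc + winLen Kb Ka * i.val)) < Mq ((cc : ℤ) - Kb)) &&
    decide (-Mq ((cc : ℤ) - Kb) < ωq i ((cc : ℤ) - Kb) * dyadToRat (dgetD loD (cc + winLen Kb Ka * i.val)))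

/-- **Hull states of a transit step stay in the open `M`-box** (the hypothesis `hhull` of glue XXII `htrap_of_branchMeshes` for step `j`).
[folklore] -/
theorem hullBound_of_checkTransit {shifts : List (ℤ × ℤ × ℤ)} (hnd : shifts.Nodup) {q : ℚ}
    {αq : Fin m → Fin m → Fin m → ℤ × ℤ × ℤ → ℚ} {ωq : Fin m → ℤ → ℚ} (hω : ∀ i k, 0 < ωq i k)
    {prec p : ℕ} {Sp Sm : IntervalD} {rec : ℕ → StepRec} {box : ℕ → BoxRec} {j : ℕ} {bD : Dyad} {Mq : ℤ → ℚ}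
    (hAA' : (rec j).A ≤ (rec j).A')
    (h13 : checkBoxCovers m Kb Ka shifts (coefBoxOf prec αq ωq Sp Sm) (rec j).x (box j).lo (box j).hi (dyadToRat bD)
      (dyadToRat (rec j).mC) (dyadToRat (rec j).ρC) (rec j).E₀ (rec j).h (rec j).A' = true)
    (htr : checkTransit m Kb Ka ωq Mq (box j).lo (box j).hi = true)
    {y : Fin m → ℤ → ℝ} (hy : hullOfB Kb Ka shifts q αq ωq prec p Sp Sm bD rec j y) :
    ∀ i k, -Kb ≤ k → k ≤ Ka → |y i k| < (Mq k : ℝ) := by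
  intro i k hk1 hk2
  have hw : -Kb ≤ k ∧ k ≤ Ka := ⟨hk1, hk2⟩
  have hb := hull_coord_bounds hnd hω hAA' h13 hy i hw
  rw [idxOf_val i hw] at hb
  simp only [checkTransit, List.all_eq_true, List.mem_finRange, List.mem_range, Bool.and_eq_true, decide_eq_true_eq,
    true_implies] at htr
  have hcc : (k + Kb).toNat < winLen Kb Ka := by
    unfold winLen; rw [Int.toNat_lt_toNat (by omega)]; omega
  obtain ⟨h1, h2⟩ := htr i (k + Kb).toNat hcc
  rw [Int.toNat_of_nonneg (by omega), show k + Kb - Kb = k by ring] at h1 h2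
  have h1r := (Rat.cast_lt (K := ℝ)).mpr h1
  have h2r := (Rat.cast_lt (K := ℝ)).mpr h2
  simp only [Rat.cast_mul, Rat.cast_neg, cast_dyadToRat] at h1r h2r
  rw [abs_lt]
  exact ⟨by linarith [hb.1], by linarith [hb.2]⟩

/-! ### One Boolean test per step -/

/-- **The once-per-certificate tests**: square-root enclosures of `(1+q)^{±1/2}`, `-1 < q`, `0 ≤ b`, and the (B)-table (C1). [folklore] -/
def checkGlobal (m : ℕ) (Kb Ka : ℤ) (prec : ℕ) (shifts : List (ℤ × ℤ × ℤ)) (αq : Fin m → Fin m → Fin m → ℤ × ℤ × ℤ → ℚ)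
    (ωq : Fin m → ℤ → ℚ) (q : ℚ) (Sp Sm : IntervalD) (bD : Dyad) : Bool :=
  sqrtCheck prec (1 + q) Sp && sqrtCheck prec (1 / (1 + q)) Sm && decide (-1 < q) && Dyad.ble (Dyad.ofInt 0) bD &&
    checkB m Kb Ka shifts (coefBoxOf prec αq ωq Sp Sm) bD

/-- **ALL TESTS OF STEP `j`** (signs, hand-over to record `j+1`, C2–C9, box covering C13, K-table, defect table, Grönwall) as one Boolean.
[folklore] -/
def checkStepBox (m : ℕ) (Kb Ka : ℤ) (prec p kexp nexp : ℕ) (shifts : List (ℤ × ℤ × ℤ))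
    (αq : Fin m → Fin m → Fin m → ℤ × ℤ × ℤ → ℚ) (ωq : Fin m → ℤ → ℚ) (Sp Sm : IntervalD) (bD : Dyad) (Eb Et : ℚ)
    (rec : ℕ → StepRec) (box : ℕ → BoxRec) (j : ℕ) : Bool :=
  let n := m * winLen Kb Ka
  let cB := coefBoxOf prec αq ωq Sp Sm
  let s := rec j
  let J := IntervalD.jetLevelsA n (pqBoxA Kb Ka prec shifts cB) prec (pointBoxA n s.x) p
  let hI := ofRatRel prec s.h
  let V := vcolsA Kb Ka prec shifts cB p J hI s.C
  let Pc := pcolsA prec n s.Cin V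
  Dyad.ble (Dyad.ofInt 0) s.mC && Dyad.ble (Dyad.ofInt 0) s.ρC && decide (0 ≤ s.E₀) && decide (s.A < s.A') &&
  decide (0 < s.h) && checkHandsOver s (rec (j + 1)) &&
  checkAbsLe n s.x s.mC && checkRowSum n s.C s.r s.ρC &&
  checkTPoly n prec (IntervalD.polyLevelsA n prec J p hI) s.x' s.dP &&
  checkNVh n (IntervalD.polyLevelsA n prec
    (IntervalD.varJetLevelsA n (pqBoxA Kb Ka prec shifts cB) prec J (unitBoxA n) p) p hI) s.NVh &&
  checkFrame n Pc s.r s.r' && checkKappa prec n s.Cn Pc V s.r s.κI &&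
  checkERec p (dyadToRat bD) (dyadToRat s.mC) (dyadToRat s.ρC) s.E₀ (dyadToRat s.κI) (dyadToRat s.dP) (dyadToRat s.NVh)
    s.h s.E₁ &&
  checkGuard (dyadToRat bD) (dyadToRat s.mC) (dyadToRat s.ρC) s.E₀ s.h &&
  checkBoxCovers m Kb Ka shifts cB s.x (box j).lo (box j).hi (dyadToRat bD) (dyadToRat s.mC) (dyadToRat s.ρC) s.E₀ s.h s.A' &&
  checkLipT m Kb Ka shifts cB (box j).lo (box j).hi (box j).K &&
  checkDefectT m Kb Ka prec shifts αq ωq Eb Et (box j).lo (box j).hi Sp Sm (box j).δ &&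
  checkGronwallK (box j).K (dyadToRat (box j).δ) s.h s.A kexp nexp

/-- **`StepCert` OF STEP `j` FROM THE TWO BOOLEANS** `checkGlobal` and `checkStepBox … j` (glue XXVIII-b with every sign / hand-over / test
hypothesis read off the Booleans), on the definitional mesh `tOf rec`. [cite: Zgliczynski2002C1Lohner, §3–4 (Lohner-type parallelepiped frames and the C¹/variational enclosure); cell certificate format, branch checker] -/
theorem stepCert_of_checkStepBox (hKb : 0 ≤ Kb) (hKa : 1 ≤ Ka) {shifts : List (ℤ × ℤ × ℤ)} (hnd : shifts.Nodup)
    (h𝕊 : IsNearestNeighbourSet shifts.toFinset) {q : ℚ}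
    {αq : Fin m → Fin m → Fin m → ℤ × ℤ × ℤ → ℚ} {ωq : Fin m → ℤ → ℚ} (hω : ∀ i k, 0 < ωq i k)
    {prec p kexp nexp : ℕ} {Sp Sm : IntervalD} {bD : Dyad} {Eb Et : ℚ} {M : ℤ → ℝ} {rec : ℕ → StepRec} {box : ℕ → BoxRec}
    {j : ℕ} (hg : checkGlobal m Kb Ka prec shifts αq ωq q Sp Sm bD = true)
    (hs : checkStepBox m Kb Ka prec p kexp nexp shifts αq ωq Sp Sm bD Eb Et rec box j = true) :
    StepCert shifts.toFinset (q : ℝ) (fun i₁ i₂ i μ => (αq i₁ i₂ i μ : ℝ)) Kb Ka (Eb : ℝ) (Et : ℝ) M (tOf rec)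
      (nodeOf Kb Ka ωq rec) (hullOfB Kb Ka shifts q αq ωq prec p Sp Sm bD rec) j := by
  simp only [checkGlobal, Bool.and_eq_true, decide_eq_true_eq, Dyad.ble_iff, Dyad.toReal_ofInt, Int.cast_zero] at hg
  obtain ⟨⟨⟨⟨hSp, hSm⟩, hq⟩, hb⟩, hchkB⟩ := hg
  simp only [checkStepBox, Bool.and_eq_true, decide_eq_true_eq, Dyad.ble_iff, Dyad.toReal_ofInt, Int.cast_zero] at hs
  obtain ⟨⟨⟨⟨⟨⟨⟨⟨⟨⟨⟨⟨⟨⟨⟨⟨⟨hmC, hρC⟩, hE₀⟩, hAA'⟩, hh⟩, hho⟩, h2⟩, h3⟩, h4⟩, h5⟩, h6⟩, h7⟩, h8⟩, h9⟩, h13⟩, h10⟩, h11⟩, h12⟩ :=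
    hs
  have hq' : 0 < 1 + (q : ℝ) := by
    have : ((-1 : ℚ) : ℝ) < (q : ℝ) := by exact_mod_cast hq
    push_cast at this; linarith
  exact stepCert_of_rec_box hKb hKa hnd h𝕊 hq' hω hSp hSm hb hmC hρC hE₀ hAA' (tOf_succ_sub rec j) (handsOver_of_check hho)
    hchkB h2 h3 h4 h5 h6 h7 h8 h9 h13 h10 h11 h12

/-- **THE PER-BRANCH PACKAGE FOR A TRANSIT BRANCH**: tests of steps `0 … N−1` and their transit tests ⇒ the mesh facts `ht0`, `hmono`, the
step certificates `hstep` and the hull bound `hhull` of glue XXII `htrap_of_branchMeshes` for this branch. [folklore] -/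
theorem transitBranch_of_checks (hKb : 0 ≤ Kb) (hKa : 1 ≤ Ka) {shifts : List (ℤ × ℤ × ℤ)} (hnd : shifts.Nodup)
    (h𝕊 : IsNearestNeighbourSet shifts.toFinset) {q : ℚ}
    {αq : Fin m → Fin m → Fin m → ℤ × ℤ × ℤ → ℚ} {ωq : Fin m → ℤ → ℚ} (hω : ∀ i k, 0 < ωq i k)
    {prec p kexp nexp : ℕ} {Sp Sm : IntervalD} {bD : Dyad} {Eb Et : ℚ} {Mq : ℤ → ℚ} {rec : ℕ → StepRec} {box : ℕ → BoxRec}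
    {N : ℕ} (hg : checkGlobal m Kb Ka prec shifts αq ωq q Sp Sm bD = true)
    (hs : ∀ j, j < N → checkStepBox m Kb Ka prec p kexp nexp shifts αq ωq Sp Sm bD Eb Et rec box j = true)
    (htr : ∀ j, j < N → checkTransit m Kb Ka ωq Mq (box j).lo (box j).hi = true) :
    tOf rec 0 = 0 ∧ (∀ j, j < N → tOf rec j < tOf rec (j + 1)) ∧
    (∀ j, j < N → StepCert shifts.toFinset (q : ℝ) (fun i₁ i₂ i μ => (αq i₁ i₂ i μ : ℝ)) Kb Ka (Eb : ℝ) (Et : ℝ)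
      (fun k => (Mq k : ℝ)) (tOf rec) (nodeOf Kb Ka ωq rec) (hullOfB Kb Ka shifts q αq ωq prec p Sp Sm bD rec) j) ∧
    (∀ j, j < N → ∀ y, hullOfB Kb Ka shifts q αq ωq prec p Sp Sm bD rec j y → ∀ i k, -Kb ≤ k → k ≤ Ka → |y i k| < (Mq k : ℝ)) := by
  refine ⟨tOf_zero rec, fun j hj => ?_, fun j hj => stepCert_of_checkStepBox hKb hKa hnd h𝕊 hω hg (hs j hj), fun j hj y hy => ?_⟩
  · have h := hs j hj
    simp only [checkStepBox, Bool.and_eq_true, decide_eq_true_eq] at h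
    exact tOf_lt_succ h.1.1.1.1.1.1.1.1.1.1.1.1.1.2
  · have h := hs j hj
    simp only [checkStepBox, Bool.and_eq_true, decide_eq_true_eq] at h
    have hAA' : (rec j).A ≤ (rec j).A' := le_of_lt h.1.1.1.1.1.1.1.1.1.1.1.1.1.1.2
    exact hullBound_of_checkTransit hnd hω hAA' h.1.1.1.2 (htr j hj) hy

end CertificateGlueOn

end Summit.NavierStokesRegularity.NavierStokesRegularity.Theorems
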